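import Summits.CriticalPhenomena.PercolationContinuityZ3.Theorems.PercNearOneGluingNoHeavyLowerTailOneCutFiveDownstream
import HarnessLib

/-!
# `NoHeavyLowerTail` (crux stmt-CriticalPhenomena-4575) — downstream of the `|A| = 5` one-cut rung, II:
# the two-parameter gluing bound and the crux's own linear lower-tail form at `|A| ≤ 5`

Support file (prover seat `prim-a5-assembly-2`; `--supports stmt-CriticalPhenomena-4575`; continuation of
`…OneCutFiveDownstream`, split off for the 400-line rule).  No definitions, no named facts, no sorries.
`μ = prodBernoulli w` on `Fin n`, relay set `A`, observer `o`, target `b`, `N = #{a ∈ A : o ↔ a}`, `E N = Σ_{a∈A} μ(o ↔ a)`.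

* `OneCutDownstream.linearGluing_of_oneCutAt'` — INSTANCE-WISE, two parameters: if the one-cut bound holds at `(w, A, o)`, then for
  every `t ≥ max_{a≠a'∈A} μ(a ↮ a')` and every `δ ≥ max_{a∈A} μ(a ↮ b)`:  `1 − μ(o ↔ b) ≤ (1 − μ(o ↔ A)) + t + 2δ`
  (relay–relay cuts enter once, relay–target cuts only through the Harris–Markov tail; `linearGluing_of_oneCutAt` is `t = 2δ`).
* `OneCutDownstream.cruxLinearForm_card_le_five_of_oneCut5` — `oneCut(5)` ⟹ for every `A.card ≤ 5` and `t ≥` the relay–relay cuts: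
  `μ{1 ≤ N < E N/2} ≤ (1 − μ(o ↔ A)) + t`, i.e. VERBATIM the `|A| ≤ 5` instance (with `C = 1`) of the linear form
  "`P(1 ≤ N < E N/2) ≤ C·(P(o ↮ A) + max_{a,a′} P(a ↮ a′))`" named in the crux item's statement — the `|A| = 5` consequence
  "as stated in the crux" that is NOT vacuous (the ε–δ restrictions are: `noHeavyLowerTail_restricted_card_le`).
HONEST LABEL: toward `|A| = 5` of the one-arm near-critical percolation programme (crux 4575); `oneCut(5)` is OPEN for `n ≥ 7`;
nothing here asserts it or the crux; SHK3⁺/E1/E3GRP are not used (ASSEMBLY.md §8).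
-/

noncomputable section

namespace Summit.CriticalPhenomena.PercolationContinuityZ3.Theorems

namespace OneCutDownstream

open MeasureTheory Set Literature.Probability.LatticeModels Literature.Probability.Percolation
open scoped Classical BigOperators

/-- **One-cut ⟹ linear gluing, two-parameter form.**  At `(w, A, o)` with the one-cut bound: for every target `b`,
every `t ≥ max_{a≠a'∈A} μ(a ↮ a')` (`t ≥ 0`) and every `δ ≥ max_{a∈A} μ(a ↮ b)` (`δ ≥ 0`),
`1 − μ(o ↔ b) ≤ (1 − μ(o ↔ A)) + t + 2δ`: cover `nhlts_cover` at threshold `E N/2`, the one-cut bound for the middle term,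
Harris–Markov `nhlts_tail` for the tail, union bound `μ(o ↔ A) ≤ E N` in the degenerate case `E N = 0`. [this work] -/
theorem linearGluing_of_oneCutAt' {n : ℕ} (w : Sym2 (Fin n) → unitInterval) (A : Finset (Fin n)) (o b : Fin n)
    (t δ : ℝ) (ht : 0 ≤ t) (hδ : 0 ≤ δ)
    (hcut : ∀ t : ℝ, 0 ≤ t →
      (∀ a ∈ A, ∀ a' ∈ A, a ≠ a' →
        (prodBernoulli w).real (openConn a a' : Set (BondConfig (Fin n)))ᶜ ≤ t) →
      (prodBernoulli w).real {ω : BondConfig (Fin n) |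
          1 ≤ (A.filter fun a => ω ∈ openConn o a).card ∧
          ((A.filter fun a => ω ∈ openConn o a).card : ℝ) <
            (∑ a ∈ A, (prodBernoulli w).real (openConn o a : Set (BondConfig (Fin n)))) / 2} ≤ t)
    (hpair : ∀ a ∈ A, ∀ a' ∈ A, a ≠ a' → (prodBernoulli w).real (openConn a a' : Set (BondConfig (Fin n)))ᶜ ≤ t)
    (hAb : ∀ a ∈ A, (prodBernoulli w).real (openConn a b : Set (BondConfig (Fin n)))ᶜ ≤ δ) :
    1 - (prodBernoulli w).real (openConn o b : Set (BondConfig (Fin n))) ≤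
      (1 - (prodBernoulli w).real (⋃ a ∈ A, (openConn o a : Set (BondConfig (Fin n))))) + t + 2 * δ := by
  set μ := prodBernoulli w with hμ
  have hmeas : ∀ s : Set (BondConfig (Fin n)), MeasurableSet s := fun _ => MeasurableSet.of_discrete
  obtain ⟨S, hS⟩ : ∃ S : ℝ, ∑ a ∈ A, μ.real (openConn o a : Set (BondConfig (Fin n))) = S := ⟨_, rfl⟩
  have hS0 : 0 ≤ S := hS ▸ Finset.sum_nonneg fun a _ => measureReal_nonneg
  have hAb' : ∀ a ∈ A, 1 - δ ≤ μ.real (openConn a b : Set (BondConfig (Fin n))) := by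
    intro a ha
    have hc : μ.real (openConn a b : Set (BondConfig (Fin n)))ᶜ =
        1 - μ.real (openConn a b : Set (BondConfig (Fin n))) := probReal_compl_eq_one_sub (hmeas _)
    have := hAb a ha
    rw [hc] at this
    linarith
  rcases hS0.eq_or_lt with hS00 | hSpos
  · have hUle : μ.real (⋃ a ∈ A, (openConn o a : Set (BondConfig (Fin n)))) ≤
        ∑ a ∈ A, μ.real (openConn o a : Set (BondConfig (Fin n))) :=
      measureReal_biUnion_finset_le A fun a => (openConn o a : Set (BondConfig (Fin n)))
    rw [hS, ← hS00] at hUle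
    have h0 : 0 ≤ μ.real (openConn o b : Set (BondConfig (Fin n))) := measureReal_nonneg
    linarith
  have hmid := hcut t ht hpair
  rw [hS] at hmid
  have hcov := nhlts_cover w A o b (S / 2)
  have htail := nhlts_tail w A o b δ (S / 2) hAb'
  rw [hS] at htail
  obtain ⟨M, hM⟩ : ∃ M : ℝ, μ.real
      ({ω | S / 2 ≤ ((A.filter fun a => ω ∈ openConn o a).card : ℝ)} ∩
        (openConn o b : Set (BondConfig (Fin n)))ᶜ) = M := ⟨_, rfl⟩
  rw [hM] at hcov htail
  have hMle : M ≤ 2 * δ := by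
    by_contra hcon
    push Not at hcon
    have h1 : S / 2 * (2 * δ) < S / 2 * M := mul_lt_mul_of_pos_left hcon (by positivity)
    have h2 : S / 2 * (2 * δ) = δ * S := by ring
    linarith
  linarith

/-- **The crux's conjectured LINEAR lower-tail form at `|A| ≤ 5` from `oneCut(5)`** (item stmt-CriticalPhenomena-4575:
"`P(1 ≤ N < E N/2) ≤ C·(P(o ↮ A) + max_{a,a′} P(a ↮ a′))` … refuters should test that form first"): with `C = 1`, for every
`A.card ≤ 5` and every `t ≥ 0` bounding the relay–relay cuts, `μ{1 ≤ N < E N/2} ≤ (1 − μ(o ↔ A)) + t`.  Weaker than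
`oneCut_card_le_five_of_oneCut5` by the nonnegative term `1 − μ(o ↔ A)`; recorded because it is verbatim the `|A| ≤ 5`
instance of the form named in the item. [this work] -/
theorem cruxLinearForm_card_le_five_of_oneCut5
    (h5 : ∀ (n : ℕ) (w : Sym2 (Fin n) → unitInterval) (A : Finset (Fin n)) (o : Fin n) (t : ℝ), A.card = 5 → 0 ≤ t →
      (∀ a ∈ A, ∀ a' ∈ A, a ≠ a' →
        (Literature.Probability.LatticeModels.prodBernoulli w).real
          (Literature.Probability.Percolation.openConn a a')ᶜ ≤ t) →
      (Literature.Probability.LatticeModels.prodBernoulli w).real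
        {ω : Literature.Probability.Percolation.BondConfig (Fin n) |
          1 ≤ (A.filter fun a => ω ∈ Literature.Probability.Percolation.openConn o a).card ∧
          ((A.filter fun a => ω ∈ Literature.Probability.Percolation.openConn o a).card : ℝ) <
            (∑ a ∈ A, (Literature.Probability.LatticeModels.prodBernoulli w).real
              (Literature.Probability.Percolation.openConn o a)) / 2} ≤ t)
    {n : ℕ} (w : Sym2 (Fin n) → unitInterval) (A : Finset (Fin n)) (o : Fin n) (hA : A.card ≤ 5)
    (t : ℝ) (ht : 0 ≤ t)
    (hpair : ∀ a ∈ A, ∀ a' ∈ A, a ≠ a' → (prodBernoulli w).real (openConn a a' : Set (BondConfig (Fin n)))ᶜ ≤ t) :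
    (prodBernoulli w).real {ω : BondConfig (Fin n) |
        1 ≤ (A.filter fun a => ω ∈ openConn o a).card ∧
        ((A.filter fun a => ω ∈ openConn o a).card : ℝ) <
          (∑ a ∈ A, (prodBernoulli w).real (openConn o a : Set (BondConfig (Fin n)))) / 2} ≤
      (1 - (prodBernoulli w).real (⋃ a ∈ A, (openConn o a : Set (BondConfig (Fin n))))) + t := by
  have h := oneCut_card_le_five_of_oneCut5 h5 n w A o t hA ht hpair
  have hU : (prodBernoulli w).real (⋃ a ∈ A, (openConn o a : Set (BondConfig (Fin n)))) ≤ 1 := measureReal_le_one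
  linarith

end OneCutDownstream

end Summit.CriticalPhenomena.PercolationContinuityZ3.Theorems

end
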